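import Mathlib
import Summits.ResolutionOfSingularities.ResolutionOfSingularities.Theorems.RadicialJungCleanModelsCleanProp44NearLineBirthDerivation
import Summits.ResolutionOfSingularities.ResolutionOfSingularities.Theorems.RadicialJungCleanModelsCleanProp44NearLineScheme
import Literature.AlgebraicGeometry.Resolution.BlowupStalkCharts
import HarnessLib

/-!
# Route `RadicialJung`, crux `CleanModels` (stmt-ResolutionOfSingularities-15917), line `Sketch` rev 35, stub 6 `stub_cleanProp44` (X44c):
# CLEAN-PERMISSIBILITY OF NEAR LINES, XII — the explicit birth test at the points of an actual point blowing up (scheme level)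

Seat decomp-res-hand-2 g18 (structural hand); scheme-level packaging of ✓ `sub_pow_not_mem_nearLine_sup_sq_of_cross`
(`…CleanProp44NearLineBirthDerivation.lean`).  Setting of ✓ `cleanPermissibleAt_nearLine_or_corner_or_birth`: `τ : X' → X` a blowing up along `J`
with `J_x = 𝔪_x` at `x = τ x'`, the line of `G` clean at `x` in form-(1) currency `(c : Fin n → 𝒪_x, u, a)` (`n ≥ 3`), NO clean side through `x'`,
and `x'` on the near line `N = (e', y')` of the regular parameter `y = Σ_k m_k c_k` (`τ♯ y = e' y'`, `y' ∈ 𝔪_{x'}`, `(e', y', z')` a regular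
system).  The CROSS ELEMENTS `w_{k₁k₂} = a_{k₁} m_{k₂} c_{k₂} - a_{k₂} m_{k₁} c_{k₁} ∈ 𝔪_x` cut out, on `E_x`, lines through the vertices; memo 4e
§2.4 (B2) says the births of `N` lie on them.  PROVED:

* `cleanPermissibleAt_nearLine_of_cross` — if NO `V(w_{k₁k₂})` passes through `x'` (`(τ♯ w_{k₁k₂}) = 𝔪_x 𝒪_{x'}` for all `k₁ ≠ k₂`), then the
  line of `τ♯ G` is CLEAN-PERMISSIBLE at `x'` for `N` (no birth): for `p ∤ Σ a` by ✓ `cleanPermissibleAt_exceptionalCurve_of_not_dvd`, for `p ∣ Σ a`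
  by the tangent derivation of the chart (✓ `sub_pow_not_mem_nearLine_sup_sq_of_cross`) and the dictionary (✓ `cleanPermissibleAt_of_unit_rep_…`).

So on a near line in an uncharged exceptional plane with no side through the point, the births are confined to the points of the lines
`V(w_{k₁k₂})` — with the corners (✓ `…NearLineFinal`) this is the complete list of candidate insertion points.  Honest framing: OURS; a TOOL; the
count «one point» needs `E_x ≅ ℙ²` and is not done.  Nothing here proves X44c, any case of `CleanModels`, or resolution of singularities in
characteristic `p`.  Setting only: [cite: CossartPiltant2008, Lemma 4.3 (5)] [cite: StacksProject, Tag 07PF] [cite: GortzWedhorn2020, Prop. 13.91].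
-/

noncomputable section

set_option linter.dupNamespace false -- mandated namespace of this single-conjunct summit

open IsLocalRing CategoryTheory AlgebraicGeometry
open Literature.AlgebraicGeometry.Resolution Literature.AlgebraicGeometry.Motives

namespace Summit.ResolutionOfSingularities.ResolutionOfSingularities.Theorems.RadicialJung.CleanModels

universe u

/-! ## §0 Generic bookkeeping (instances derived from `CommRing`, so that the chart ring's arithmetic matches the abstract lemmas) -/

section Generic

variable {A S : Type*} [CommRing A] [CommRing S]

/-- `χ` on a cross element. [folklore] -/
private theorem map_cross_eq (χ : A →+* S) (a₁ a₂ : ℕ) (x₁ x₂ y₁ y₂ : A) :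
    χ ((a₁ : A) * (x₂ * y₂) - (a₂ : A) * (x₁ * y₁)) = (a₁ : S) * (χ x₂ * χ y₂) - (a₂ : S) * (χ x₁ * χ y₁) := by
  simp only [map_sub, map_mul, map_natCast]

/-- `χ` on a monomial. [folklore] -/
private theorem map_mul_prod_pow_eq (χ : A →+* S) {n : ℕ} (x : A) (g : Fin n → A) (a : Fin n → ℕ) :
    χ (x * ∏ k, g k ^ a k) = χ x * ∏ k, χ (g k) ^ a k := by
  simp only [map_mul, map_prod, map_pow]

/-- `χ` on a linear combination. [folklore] -/
private theorem map_sum_mul_eq (χ : A →+* S) {n : ℕ} (x g : Fin n → A) : χ (∑ k, x k * g k) = ∑ k, χ (x k) * χ (g k) := by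
  simp only [map_sum, map_mul]

/-- An element whose image is a unit of the local ring `S` is not in the contracted prime. [folklore] -/
private theorem not_mem_of_isUnit_map [IsLocalRing S] (χ : A →+* S) (𝔴 : Ideal A) (hmem : ∀ z, χ z ∈ maximalIdeal S ↔ z ∈ 𝔴) {z : A}
    (hz : IsUnit (χ z)) : z ∉ 𝔴 :=
  fun h => mem_nonunits_iff.mp ((mem_maximalIdeal _).mp ((hmem z).mpr h)) hz

/-- The cross element is not in `𝔴` when its image is a unit. [folklore] -/
private theorem cross_not_mem [IsLocalRing S] (χ : A →+* S) (𝔴 : Ideal A) (hmem : ∀ z, χ z ∈ maximalIdeal S ↔ z ∈ 𝔴) (a₁ a₂ : ℕ)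
    (x₁ x₂ y₁ y₂ : A) (hunit : IsUnit ((a₁ : S) * (χ x₂ * χ y₂) - (a₂ : S) * (χ x₁ * χ y₁))) :
    (a₁ : A) * (x₂ * y₂) - (a₂ : A) * (x₁ * y₁) ∉ 𝔴 := by
  refine not_mem_of_isUnit_map χ 𝔴 hmem ?_
  rw [map_cross_eq]; exact hunit

/-- A unit times a product of powers of elements outside the prime `𝔴` (for the non-zero exponents) is outside `𝔴`. [folklore] -/
private theorem mul_prod_pow_not_mem (𝔴 : Ideal A) [h𝔴 : 𝔴.IsPrime] {n : ℕ} (x : A) (hx : x ∉ 𝔴) (g : Fin n → A) (a : Fin n → ℕ)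
    (hg : ∀ k, a k ≠ 0 → g k ∉ 𝔴) : x * ∏ k, g k ^ a k ∉ 𝔴 := by
  intro h
  rcases h𝔴.mem_or_mem h with h1 | h1
  · exact hx h1
  · rw [Ideal.IsPrime.prod_mem_iff] at h1
    obtain ⟨k, -, hk⟩ := h1
    rcases Nat.eq_zero_or_pos (a k) with h0 | hpos
    · rw [h0, pow_zero] at hk
      exact h𝔴.ne_top' ((Ideal.eq_top_iff_one _).mpr hk)
    · exact hg k (by omega) (h𝔴.mem_of_pow_mem _ hk)

/-- A linear combination lies in `𝔴` when its image lies in `𝔪_S`. [folklore] -/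
private theorem sum_mul_mem_of_map [IsLocalRing S] (χ : A →+* S) (𝔴 : Ideal A) (hmem : ∀ z, χ z ∈ maximalIdeal S ↔ z ∈ 𝔴) {n : ℕ}
    (x g : Fin n → A) (h : ∑ k, χ (x k) * χ (g k) ∈ maximalIdeal S) : (∑ k, x k * g k) ∈ 𝔴 := by
  rw [← hmem, map_sum_mul_eq]; exact h

end Generic

/-! ## §1 The birth test at scheme level -/

section Scheme

variable {p : ℕ} {X X' : Scheme.{u}} [IsIntegral X] [IsIntegral X'] {τ : X' ⟶ X} [IsDominant τ] {J : X.IdealSheafData}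

set_option maxHeartbeats 1600000 in
-- stalk-level bookkeeping through the Rees chart presentation
/-- **THE BIRTH TEST at a point of a point blowing up**: no clean side and no cross line `V(w_{k₁k₂})` through `x'` ⟹ the near line is
clean-permissible at `x'`.  See the module docstring. [cite: CossartPiltant2008, Lemma 4.3 (5)] [cite: StacksProject, Tag 07PF] -/
theorem cleanPermissibleAt_nearLine_of_cross [Fact p.Prime] [CharP X.functionField p] (hτ : IsBlowup τ J) (x' : X')
    (hR : IsRegularLocalRing (X.presheaf.stalk (τ x'))) {n : ℕ} (hn : 3 ≤ n) (c : Fin n → X.presheaf.stalk (τ x'))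
    (hc : Ideal.span (Set.range c) = maximalIdeal (X.presheaf.stalk (τ x')))
    (hdim : ringKrullDim (X.presheaf.stalk (τ x')) = (n : WithBot ℕ∞)) (hJ : stalkIdeal J (τ x') = maximalIdeal (X.presheaf.stalk (τ x')))
    {G : X.functionField} {cc : Fin p → X.functionField} (hcc : ∃ j : Fin p, (j : ℕ) ≠ 0 ∧ cc j ≠ 0)
    {u : X.presheaf.stalk (τ x')} (hu : IsUnit u) {a : Fin n → ℕ}
    (hrep : (∑ j : Fin p, cc j ^ p * G ^ (j : ℕ)) = RatFn.toFunctionField (τ x') (u * ∏ k, c k ^ a k))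
    (hsides : ∀ k, a k ≠ 0 → Ideal.span {(τ.stalkMap x').hom (c k)} = (maximalIdeal (X.presheaf.stalk (τ x'))).map (τ.stalkMap x').hom)
    (hdim' : ringKrullDim (X'.presheaf.stalk x') = 3) (m : Fin n → X.presheaf.stalk (τ x')) {e' y' z' : X'.presheaf.stalk x'}
    (he' : Ideal.span {e'} = (maximalIdeal (X.presheaf.stalk (τ x'))).map (τ.stalkMap x').hom)
    (hy' : (τ.stalkMap x').hom (∑ k, m k * c k) = e' * y') (hy'm : y' ∈ maximalIdeal (X'.presheaf.stalk x'))
    (hzz : Ideal.span ({e', y', z'} : Set (X'.presheaf.stalk x')) = maximalIdeal (X'.presheaf.stalk x'))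
    (hW : ∀ k₁ k₂ : Fin n, k₁ ≠ k₂ →
      Ideal.span {(τ.stalkMap x').hom ((a k₁ : X.presheaf.stalk (τ x')) * (m k₂ * c k₂) - (a k₂ : X.presheaf.stalk (τ x')) * (m k₁ * c k₁))} =
        (maximalIdeal (X.presheaf.stalk (τ x'))).map (τ.stalkMap x').hom) :
    CleanPermissibleAt p (RatFn.toFunctionField x') (RatFn.functionFieldMap τ G) (Ideal.span ({e', y'} : Set (X'.presheaf.stalk x'))) := by
  classical
  haveI := hR
  haveI : CharP X'.functionField p := charP_of_injective_ringHom (RatFn.functionFieldMap τ).injective p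
  haveI : CharP (X.presheaf.stalk (τ x')) p := (RatFn.toFunctionField (τ x')).charP (RatFn.toFunctionField_injective _) p
  -- the form-(1) currency of `…NearLineScheme`: `w = ∅`
  have hz : Ideal.span (Set.range (Fin.append c Fin.elim0)) = maximalIdeal (X.presheaf.stalk (τ x')) := by
    rw [Fin.append_elim0]
    have hsurj : Function.Surjective (Fin.cast (Nat.add_zero n)) := fun i => ⟨Fin.cast (Nat.add_zero n).symm i, Fin.ext rfl⟩
    rw [hsurj.range_comp, hc]
  have hdim0 : ringKrullDim (X.presheaf.stalk (τ x')) = ((n + 0 : ℕ) : WithBot ℕ∞) := by rw [Nat.add_zero]; exact hdim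
  have hcJ : Ideal.span (Set.range c) = stalkIdeal J (τ x') := hc.trans hJ.symm
  have hrep' : (∑ j : Fin p, cc j ^ p * G ^ (j : ℕ)) =
      RatFn.toFunctionField (τ x') (u * (∏ k, c k ^ a k) * ∏ m' : Fin 0, (Fin.elim0 m' : X.presheaf.stalk (τ x')) ^ (Fin.elim0 m' : ℕ)) := by
    rw [hrep, Fin.prod_univ_zero, mul_one]
  have he'J : Ideal.span {e'} = (stalkIdeal J (τ x')).map (τ.stalkMap x').hom := by rw [hJ]; exact he'
  have hsidesJ : ∀ k, a k ≠ 0 → Ideal.span {(τ.stalkMap x').hom (c k)} = (stalkIdeal J (τ x')).map (τ.stalkMap x').hom := by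
    intro k hk; rw [hsides k hk, hJ]
  by_cases hA : p ∣ ∑ k, a k
  swap
  · exact cleanPermissibleAt_exceptionalCurve_of_not_dvd hτ x' hR c Fin.elim0 hz hdim0 hcJ hcc hu hrep' (fun m' => m'.elim0) hsidesJ hA
      hdim' he'J hzz
  -- the Rees chart at `x'`
  obtain ⟨i, 𝔴, χ, hχ, hloc, hcomap⟩ := hτ.exists_reesChart_stalk x' c hcJ
  letI := χ.toAlgebra
  haveI := hloc
  haveI : IsNoetherianRing (chartRing c i) := isNoetherianRing_blowupChart c i
  have hL : IsRegularLocalRing (X'.presheaf.stalk x') :=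
    isRegularLocalRing_chart c i Fin.elim0 (span_range_append_elim0 c hc) (spanFinrank_eq_add_zero hdim) (X'.presheaf.stalk x')
      (chartBase c i) (chartGen c i) (reesChartBase_mem_nonZeroDivisors _ _)
      (chartQuotEquiv c i (isQuasiRegular_centre c Fin.elim0 (span_range_append_elim0 c hc) (spanFinrank_eq_add_zero hdim)))
      (chartQuotMap_C c i) (chartQuotMap_X c i) 𝔴.asIdeal hcomap
  haveI := isDomain_of_isRegularLocalRing (X'.presheaf.stalk x')
  have hmem : ∀ z : chartRing c i, χ z ∈ maximalIdeal (X'.presheaf.stalk x') ↔ z ∈ 𝔴.asIdeal := fun z =>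
    IsLocalization.AtPrime.to_map_mem_maximal_iff (X'.presheaf.stalk x') 𝔴.asIdeal z
  have hrel : ∀ k, (τ.stalkMap x').hom (c k) = χ (chartBase c i (c i)) * χ (chartGen c i k) := fun k => by
    rw [← hχ, ← map_mul, reesChartBase_apply_eq_mul_chartGen c i k]
  have hE : Ideal.span {χ (chartBase c i (c i))} = (maximalIdeal (X.presheaf.stalk (τ x'))).map (τ.stalkMap x').hom := by
    rw [← hc, hχ]
    refine span_singleton_eq_map_span_of_rel _ c i (fun k => χ (chartGen c i k)) fun k => ?_
    rw [hrel k, hχ]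
  obtain ⟨v, hv⟩ : Associated e' (χ (chartBase c i (c i))) := Ideal.span_singleton_eq_span_singleton.mp (he'.trans hE.symm)
  have he0 : χ (chartBase c i (c i)) ≠ 0 := by
    intro h0
    have h2 : algebraMap (chartRing c i) (X'.presheaf.stalk x') (chartBase c i (c i)) ∈ nonZeroDivisors (X'.presheaf.stalk x') :=
      IsLocalization.nonZeroDivisors_le_comap 𝔴.asIdeal.primeCompl (X'.presheaf.stalk x') (reesChartBase_mem_nonZeroDivisors _ _)
    have h3 : χ (chartBase c i (c i)) ∈ nonZeroDivisors (X'.presheaf.stalk x') := h2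
    rw [h0] at h3
    exact zero_notMem_nonZeroDivisors h3
  have he'0 : e' ≠ 0 := left_ne_zero_of_mul (hv.symm ▸ he0)
  -- every `u_k` with `a_k ≠ 0` is a unit at `x'` (no side through `x'`)
  have hunitk : ∀ k, a k ≠ 0 → chartGen c i k ∉ 𝔴.asIdeal := by
    intro k hk hk𝔴
    have hspan := hsides k hk
    rw [← hE, hrel] at hspan
    exact mem_nonunits_iff.mp ((mem_maximalIdeal _).mp ((hmem _).mpr hk𝔴)) (isUnit_of_span_singleton_mul_eq he0 hspan)
  -- `b = u · ∏ u_k^{a_k} ∉ 𝔴`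
  have hu𝔴 : chartBase c i u ∉ 𝔴.asIdeal := not_mem_of_isUnit_map χ 𝔴.asIdeal hmem (by rw [hχ]; exact hu.map _)
  have hb := mul_prod_pow_not_mem 𝔴.asIdeal (chartBase c i u) hu𝔴 (chartGen c i) a hunitk
  -- the near line in the chart
  have hsum : χ (chartBase c i (c i)) * ∑ k, (τ.stalkMap x').hom (m k) * χ (chartGen c i k) = e' * y' := by
    rw [← hy', map_sum, Finset.mul_sum]
    refine Finset.sum_congr rfl fun k _ => ?_
    rw [map_mul, hrel k]; ring
  have hLy : ∑ k, (τ.stalkMap x').hom (m k) * χ (chartGen c i k) = ↑v⁻¹ * y' := by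
    rw [← hv, mul_assoc] at hsum
    have h2 := mul_left_cancel₀ he'0 hsum
    rw [← h2, ← mul_assoc, Units.inv_mul, one_mul]
  have hLy𝔴 := sum_mul_mem_of_map χ 𝔴.asIdeal hmem (fun k => chartBase c i (m k)) (chartGen c i) (by
    have h1 : ∑ k, χ (chartBase c i (m k)) * χ (chartGen c i k) = ∑ k, (τ.stalkMap x').hom (m k) * χ (chartGen c i k) :=
      Finset.sum_congr rfl fun k _ => by rw [hχ]
    rw [h1, hLy]; exact Ideal.mul_mem_left _ _ hy'm)
  -- two indices different from `i`
  obtain ⟨k₁, k₂, hk₁, hk₂, hk⟩ : ∃ k₁ k₂ : Fin n, k₁ ≠ i ∧ k₂ ≠ i ∧ k₁ ≠ k₂ := by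
    have hcard : 3 ≤ (Finset.univ.erase i : Finset (Fin n)).card + 1 := by
      rw [Finset.card_erase_of_mem (Finset.mem_univ i), Finset.card_univ, Fintype.card_fin]; omega
    obtain ⟨k₁, hk₁⟩ : (Finset.univ.erase i : Finset (Fin n)).Nonempty := Finset.card_pos.mp (by omega)
    have hcard2 : 1 ≤ ((Finset.univ.erase i).erase k₁ : Finset (Fin n)).card := by
      rw [Finset.card_erase_of_mem hk₁]; omega
    obtain ⟨k₂, hk₂⟩ : ((Finset.univ.erase i).erase k₁ : Finset (Fin n)).Nonempty := Finset.card_pos.mp hcard2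
    exact ⟨k₁, k₂, Finset.ne_of_mem_erase hk₁, Finset.ne_of_mem_erase (Finset.mem_of_mem_erase hk₂), (Finset.ne_of_mem_erase hk₂).symm⟩
  -- the cross element is a unit at `x'`
  have hcrossU : IsUnit ((a k₁ : X'.presheaf.stalk x') * (χ (chartBase c i (m k₂)) * χ (chartGen c i k₂)) -
      (a k₂ : X'.presheaf.stalk x') * (χ (chartBase c i (m k₁)) * χ (chartGen c i k₁))) := by
    have hspan := hW k₁ k₂ hk
    have h1 : (τ.stalkMap x').hom ((a k₁ : X.presheaf.stalk (τ x')) * (m k₂ * c k₂) - (a k₂ : X.presheaf.stalk (τ x')) * (m k₁ * c k₁)) =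
        χ (chartBase c i (c i)) * ((a k₁ : X'.presheaf.stalk x') * (χ (chartBase c i (m k₂)) * χ (chartGen c i k₂)) -
          (a k₂ : X'.presheaf.stalk x') * (χ (chartBase c i (m k₁)) * χ (chartGen c i k₁))) := by
      rw [map_sub, map_mul, map_mul, map_mul, map_mul, map_natCast, map_natCast, hrel k₁, hrel k₂]
      simp only [hχ]
      ring
    rw [h1, ← hE] at hspan
    exact isUnit_of_span_singleton_mul_eq he0 hspan
  have hcross := cross_not_mem χ 𝔴.asIdeal hmem (a k₁) (a k₂) (chartBase c i (m k₁)) (chartBase c i (m k₂)) (chartGen c i k₁) (chartGen c i k₂)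
    hcrossU
  -- the abstract birth test, read in `𝒪_{X',x'}`
  have hnb : ∀ c'' : X'.presheaf.stalk x', (τ.stalkMap x').hom u * ∏ k, χ (chartGen c i k) ^ a k - c'' ^ p ∉
      Ideal.span ({e', y'} : Set (X'.presheaf.stalk x')) ⊔ maximalIdeal (X'.presheaf.stalk x') ^ 2 := by
    intro c''
    have h0 : χ (chartBase c i u) * ∏ k, χ (chartGen c i k) ^ a k - c'' ^ p ∉
        Ideal.span {χ (chartBase c i (c i)), ∑ k, χ (chartBase c i (m k)) * χ (chartGen c i k)} ⊔ maximalIdeal (X'.presheaf.stalk x') ^ 2 :=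
      sub_pow_not_mem_nearLine_sup_sq_of_cross' c i hc (chartBase c i) (chartGen c i) (reesChartBase_apply_eq_mul_chartGen c i)
        (reesChartBase_mem_nonZeroDivisors _ _)
        (chartQuotEquiv c i (isQuasiRegular_centre c Fin.elim0 (span_range_append_elim0 c hc) (spanFinrank_eq_add_zero hdim)))
        (chartQuotMap_C c i) (chartQuotMap_X c i) 𝔴.asIdeal hcomap (X'.presheaf.stalk x') p m hLy𝔴 a hb k₁ k₂ hk₁ hk₂ hk hcross c''
    have h1 : ∑ k, χ (chartBase c i (m k)) * χ (chartGen c i k) = ↑v⁻¹ * y' := by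
      rw [← hLy]; exact Finset.sum_congr rfl fun k _ => by rw [hχ]
    have hspe : Ideal.span ({χ (chartBase c i (c i))} : Set (X'.presheaf.stalk x')) = Ideal.span {e'} := (he'.trans hE.symm).symm
    have hspy : Ideal.span ({↑v⁻¹ * y'} : Set (X'.presheaf.stalk x')) = Ideal.span {y'} := Ideal.span_singleton_mul_left_unit (Units.isUnit v⁻¹) _
    have hN : Ideal.span ({χ (chartBase c i (c i)), ∑ k, χ (chartBase c i (m k)) * χ (chartGen c i k)} : Set (X'.presheaf.stalk x')) =
        Ideal.span {e', y'} := by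
      rw [h1, Ideal.span_insert, hspe, hspy, ← Ideal.span_insert]
    rw [hN, hχ] at h0
    exact h0
  -- the transform and the dictionary
  have htrans : (τ.stalkMap x').hom (u * ∏ k, c k ^ a k) =
      ((τ.stalkMap x').hom u * ∏ k, χ (chartGen c i k) ^ a k) * χ (chartBase c i (c i)) ^ (∑ k, a k) := by
    have h1 : (τ.stalkMap x').hom (u * ∏ k, c k ^ a k) =
        (τ.stalkMap x').hom u * ∏ k, (χ (chartBase c i (c i)) ^ a k * χ (chartGen c i k) ^ a k) := by
      rw [map_mul, map_prod]
      congr 1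
      exact Finset.prod_congr rfl fun k _ => by rw [map_pow, hrel k, mul_pow]
    rw [h1, Finset.prod_mul_distrib, Finset.prod_pow_eq_pow_sum]
    ring
  have hbU : IsUnit ((τ.stalkMap x').hom u * ∏ k, χ (chartGen c i k) ^ a k) := by
    have h1 := map_mul_prod_pow_eq χ (chartBase c i u) (chartGen c i) a
    rw [hχ] at h1
    rw [← h1]
    exact IsLocalRing.notMem_maximalIdeal.mp fun hm => hb ((hmem _).mp hm)
  obtain ⟨hcc', hrepι⟩ := rep_functionFieldMap x' hcc hrep
  rw [htrans] at hrepι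
  have hrepU := rep_eq_mul_pow_of_dvd (RatFn.toFunctionField x') (fun j => RatFn.functionFieldMap τ (cc j)) hA hrepι
  have hd : RatFn.toFunctionField x' (χ (chartBase c i (c i))) ^ ((∑ k, a k) / p) ≠ 0 :=
    pow_ne_zero _ ((map_ne_zero_iff _ (RatFn.toFunctionField_injective x')).mpr he0)
  by_cases h : ∃ c'' : X'.presheaf.stalk x', (τ.stalkMap x').hom u * ∏ k, χ (chartGen c i k) ^ a k - c'' ^ p ∈ maximalIdeal (X'.presheaf.stalk x')
  · obtain ⟨c'', hc''⟩ := h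
    exact cleanPermissibleAt_of_unit_rep_of_transversal (RatFn.toFunctionField x') hL hdim' hzz _ hcc' hd hrepU hc'' (hnb c'')
  · push Not at h
    exact cleanPermissibleAt_of_unit_rep_of_forall (RatFn.toFunctionField x') hL hdim' hzz _ hcc' hbU hd hrepU h

end Scheme

end Summit.ResolutionOfSingularities.ResolutionOfSingularities.Theorems.RadicialJung.CleanModels

end
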